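import Summits.QuantumFields.YangMills.Theorems.BalabanUVNodesN15KingModelCovariantBlockPositivity
import Literature.LinearAlgebra.Matrix.RayleighQuotient
import HarnessLib

/-!
# BalabanUVNodes ∕ N15 — THE KING-MODEL RUNG (PART Ϥ-k): THE BLOCK-FIELD COVARIANCE AT EVERY LINK FIELD — King's effective Laplacian `Δ_eff(U) = a − a²Q(U)G(U)Q(U)^*` ((2.14)∕(4.5),
# `G(U) = A₀(U)⁻¹`) with Bałaban's covariant block mean, at an ARBITRARY unitary `U` (massive fine covariance, `m² > 0`): ★★★ THE WOODBURY FORM `(Δ_eff(U))⁻¹ = a⁻¹·1 + Q(U)(−cΔ_U+m²)⁻¹Q(U)^*`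
# — block-spin noise plus the covariant block average of the covariant fine covariance — EXACTLY, for every `U` and every tree contour system; hence the `U`-UNIFORM FORM SANDWICH
# `a⁻¹‖f‖² ≤ Re⟨f,(Δ_eff(U))⁻¹f⟩ ≤ (a⁻¹ + m⁻²)‖f‖²` (NE2's unit layer in operator norm, the curved twin of PART Ϟ-h's `A = 0` sandwich)
# (Track A, DAG node N15 = NE2; FAN-OUT v1.1 §N15 s3 «KING-MODEL RUNG … + what the curved case adds»; count-neutral)

HONEST FRAMING.  Count-neutral (cell `pub-ymgap`, seat `pub-ymgap-dag-n15-e` g49; `--supports stmt-QuantumFields-27247 --as helper` = K3ᴬ, KEY MAP v3).  King's comparison model: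
[King1986] (2.14) p.653 `Δ^{(k)} = a_k(L^kε)^{−2}I − a_k²(L^kε)^{−4}Q_k(A)G^ε_k(Ω,A)Q_k(A)^*` with King's `Q_k(A)` replaced by Bałaban's one-level covariant mean (3.19) of PART Ϥ-c (any fibre, any
tree contour system); the Woodbury form is the tree's `N15KingModelRung.effLaplacian_inv_eq_noise_add_blockAvg` ((2.13)–(2.14)∕(4.44)–(4.45) at `A = 0`) now AT EVERY `U`.  MASSIVE
fine covariance only (`m² > 0`: at `m² = 0` the fine covariance `(−cΔ_U)⁻¹` need not exist at flat `U`, Ͱ-f); the massless block-field covariance exists at every `U` by PART Ϥ-e but has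
no such Woodbury form.  NOT Bałaban's multi-level `G_k(U)`; NOT (3.42); NOT a node discharge (N15 of record untouched); nothing continuum ∕ ℝ⁴ ∕ OS ∕ Clay.

RESULTS: §1 def `effLapU T M a c m² U = a·1 − a²·Q(U)A₀(U)⁻¹Q(U)^*` (King (2.14) with the covariant mean), ★ `re_quadForm_fullOpU_ge_mass` (`m²Σ‖v_x‖² ≤ Re⟨v,A₀(U)v⟩`), `posDef_fullOpU_massive`,
`isUnit_fullOpU_massive` (`m² > 0`, `a ≥ 0`, `c ≥ 0`, every unitary `U`), `fullOpU_eq_covLapF_add` (`A₀ = M_U + a·Q^*Q`); §2 ★★★ **`effLapU_mul_noise_add_blockAvg`** (`Δ_eff(U)·(a⁻¹1 + Q M_U⁻¹Q^*) = 1`),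
★★★ **`effLapU_inv_eq_noise_add_blockAvg`** (THE WOODBURY FORM AT EVERY `U`), `isUnit_effLapU`; §3 ★ `re_quadForm_kingQadjU_sandwich` (`Re⟨f,Q M_U⁻¹Q^*f⟩ = L^{d+1}Re⟨Qᴴf,M_U⁻¹Qᴴf⟩`), ★
`sum_norm_sq_conjTranspose_covQ_mulVec` (`L^{d+1}‖Qᴴf‖² = ‖f‖²`, from `QQᴴ = L^{−(d+1)}`), ★★★ **`re_quadForm_effLapU_inv_ge`** (`a⁻¹‖f‖² ≤ Re⟨f,(Δ_eff(U))⁻¹f⟩`), ★★★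
**`re_quadForm_effLapU_inv_le`** (`≤ (a⁻¹ + m⁻²)‖f‖²`), ★★ `king_blockField_covariance_sandwich` (both, every `U`: the block-field covariance form is pinned between the noise and noise + `m⁻²`,
uniformly in `U`, `L`, the volume).
PRIOR TREE ART (by name): Ϥ-c (`covQ`, `covQ_mul_conjTranspose`), Ϥ-d (`kingQadjU`, `blockProjU`, `fullOpU`, `fullOpU_eq`, `blockProjU_eq_kingQadjU_mul`, `isHermitian_fullOpU`, `re_quadForm_fullOpU_ge_covLapF`),
Ϥ-e engines, Ͱ-a (`covLapF`, `covLapF_mul_inv`, `covLapF_inv_mul`, `posDef_covLapF_inv`), Ͱ-f (`re_quadForm_covLapF_ge`, `norm_toLp_inv_mulVec_le`, `sum_norm_fib_sq`, `re_star_dotProduct_le_norm_mul_norm`),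
`N15KingModelRung.effLaplacian_inv_eq_noise_add_blockAvg` (the `A = 0` twin), Mathlib (`Matrix.inv_eq_right_inv`).  Dedup (rg at filing): basename 0 files; needles `effLapU|noise_add_blockAvg` —
`effLaplacian_inv_eq_noise_add_blockAvg` (King, `A = 0`) and Ͷ-n `effLapTw_inv_eq_noise_add_blockAvg` (torons) exist: DIFFERENT objects (real ∕ toron), cited; 0 files for `effLapU`.  presearch: n/a
(Woodbury identity; [King1986] (4.44)–(4.45)).  Locators: [King1986] (2.13)–(2.14) p.653, (4.5) p.670, (4.44)–(4.45) p.675; [Balaban1985BackgroundPropagators] (3.19) p.393, (3.24)–(3.27) p.394–395;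
[Balaban1984PropagatorsI] (1.29) p.23.  0 `sorry`.
-/

noncomputable section
open scoped BigOperators ComplexConjugate ComplexOrder Matrix.Norms.L2Operator
open Finset Matrix WithLp

namespace Summit.QuantumFields.YangMills.BalabanUVNodes.N15KingModelRung.CovariantBlock

open Literature.MathematicalPhysics.QuantumFieldTheory.Balaban1983to89.B5Prop11Plancherel (Tor fine unitVec)
open Literature.MathematicalPhysics.QuantumFieldTheory.King1986.Torus (site)
open Summit.QuantumFields.YangMills.BalabanUVNodes.N15KingModelRung.Covariant
  (covLapF isHermitian_covLapF covLapF_mul_inv covLapF_inv_mul posDef_covLapF_inv fib fib_apply sum_norm_fib_sq re_quadForm_covLapF_ge norm_toLp_inv_mulVec_le re_star_dotProduct_le_norm_mul_norm)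
open Summit.QuantumFields.YangMills.BalabanUVNodes.N15KingModelRung.Landau (posDef_of_coercive')

variable {d : ℕ} {L : ℕ} [NeZero L] (T : BlockTree d L) (M : Fin (d + 1) → ℕ) [hM : ∀ μ, NeZero (M μ)]
variable {𝕜 : Type*} [RCLike 𝕜] {n : Type*} [Fintype n] [DecidableEq n]

/-! ## §1 King's effective Laplacian with the covariant mean; the massive full operator is invertible at every `U` -/

/-- KING's EFFECTIVE LAPLACIAN of the block field at the link field `U`: `Δ_eff(U) = a·1 − a²·Q(U)·A₀(U)⁻¹·Q(U)^*` ((2.14)∕(4.5) with Bałaban's covariant block mean and King's `η`-adjoint).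
[cite: King1986, (2.14) p.653, (4.5) p.670; Balaban1985BackgroundPropagators, (3.19) p.393, (3.24) p.394] -/
def effLapU (a c m2 : ℝ) (U : Tor (fine L M) × Fin (d + 1) → Matrix n n 𝕜) : Matrix (Tor M × n) (Tor M × n) 𝕜 :=
  (a : 𝕜) • (1 : Matrix (Tor M × n) (Tor M × n) 𝕜) - ((a ^ 2 : ℝ) : 𝕜) • (covQ T M U * (fullOpU T M a c m2 U)⁻¹ * kingQadjU T M U)

/-- ★ THE MASS FLOOR OF THE FULL OPERATOR: `m²·Σ‖v_x‖² ≤ Re⟨v,A₀(U)v⟩` (`c, a ≥ 0`, unitary `U`). [cite: Balaban1985BackgroundPropagators, (3.24) p.394] -/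
theorem re_quadForm_fullOpU_ge_mass {a c : ℝ} (ha : 0 ≤ a) (hc : 0 ≤ c) (m2 : ℝ) {U : Tor (fine L M) × Fin (d + 1) → Matrix n n 𝕜} (hU : ∀ bd, U bd ∈ Matrix.unitaryGroup n 𝕜)
    (v : Tor (fine L M) × n → 𝕜) : m2 * ∑ x, ‖fib (fine L M) v x‖ ^ 2 ≤ RCLike.re (star v ⬝ᵥ (fullOpU T M a c m2 U *ᵥ v)) :=
  re_quadForm_fullOpU_ge_covLapF T M ha c m2 U (fun w => by rw [sum_norm_fib_sq]; exact re_quadForm_covLapF_ge (fine L M) hc m2 hU w) v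

/-- The massive full operator is positive definite at every unitary `U` (`m² > 0`, `a, c ≥ 0`). [cite: Balaban1985BackgroundPropagators, (3.24)–(3.27) p.394–395] -/
theorem posDef_fullOpU_massive {a c m2 : ℝ} (ha : 0 ≤ a) (hc : 0 ≤ c) (hm : 0 < m2) {U : Tor (fine L M) × Fin (d + 1) → Matrix n n 𝕜} (hU : ∀ bd, U bd ∈ Matrix.unitaryGroup n 𝕜) :
    (fullOpU T M a c m2 U).PosDef :=
  posDef_of_coercive' (fine L M) (isHermitian_fullOpU T M a c m2 U) hm (re_quadForm_fullOpU_ge_mass T M ha hc m2 hU)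

/-- … hence invertible: King's full propagator `G(U) = A₀(U)⁻¹` exists at every `U`. [cite: King1986, (2.13) p.653; Balaban1985BackgroundPropagators, (3.27) p.395] -/
theorem isUnit_fullOpU_massive {a c m2 : ℝ} (ha : 0 ≤ a) (hc : 0 ≤ c) (hm : 0 < m2) {U : Tor (fine L M) × Fin (d + 1) → Matrix n n 𝕜} (hU : ∀ bd, U bd ∈ Matrix.unitaryGroup n 𝕜) :
    IsUnit (fullOpU T M a c m2 U) :=
  (posDef_fullOpU_massive T M ha hc hm hU).isUnit

/-- `A₀(U) = M_U + a·(Q(U)^*Q(U))` with `M_U = −cΔ_U + m²`. [cite: King1986, (2.13) p.653] -/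
theorem fullOpU_eq_covLapF_add (a c m2 : ℝ) (U : Tor (fine L M) × Fin (d + 1) → Matrix n n 𝕜) :
    fullOpU T M a c m2 U = covLapF (fine L M) c m2 U + (a : 𝕜) • (kingQadjU T M U * covQ T M U) := by
  rw [fullOpU_eq, blockProjU_eq_kingQadjU_mul]

/-! ## §2 The Woodbury form at every `U` -/

/-- ★★★ **`Δ_eff(U)·(a⁻¹·1 + Q(U)M_U⁻¹Q(U)^*) = 1`** (`a > 0`, `m² > 0`, `c ≥ 0`, unitary `U`): with `G = A₀⁻¹`, `A₀ = M + aQ^*Q`: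
`(a − a²QGQ^*)(a⁻¹ + QM⁻¹Q^*) = 1 + aQM⁻¹Q^* − aQGQ^* − aQG(aQ^*Q)M⁻¹Q^*` and `aQ^*Q = A₀ − M` turns the last term into `aQM⁻¹Q^* − aQGQ^*`.
[cite: King1986, (2.14) p.653, (4.44)–(4.45) p.675; Balaban1985BackgroundPropagators, (3.25) p.394] -/
theorem effLapU_mul_noise_add_blockAvg {a c m2 : ℝ} (ha : 0 < a) (hc : 0 ≤ c) (hm : 0 < m2) {U : Tor (fine L M) × Fin (d + 1) → Matrix n n 𝕜} (hU : ∀ bd, U bd ∈ Matrix.unitaryGroup n 𝕜) :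
    effLapU T M a c m2 U * ((a⁻¹ : 𝕜) • 1 + covQ T M U * (covLapF (fine L M) c m2 U)⁻¹ * kingQadjU T M U) = 1 := by
  set Q := covQ T M U with hQ
  set Qs := kingQadjU T M U with hQs
  set Mi := (covLapF (fine L M) c m2 U)⁻¹ with hMi
  set A := fullOpU T M a c m2 U with hA
  set G := A⁻¹ with hG
  have ha0 : (a : 𝕜) ≠ 0 := by exact_mod_cast ha.ne'
  have hGA : G * A = 1 := Matrix.nonsing_inv_mul _ ((Matrix.isUnit_iff_isUnit_det _).mp (isUnit_fullOpU_massive T M ha.le hc hm hU))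
  have hMMi : covLapF (fine L M) c m2 U * Mi = 1 := covLapF_mul_inv (fine L M) hc hm hU
  -- `Qs * Q = a⁻¹•(A − M)`
  have hpen : (a : 𝕜) • (Qs * Q) = A - covLapF (fine L M) c m2 U := by rw [hA, fullOpU_eq_covLapF_add]; abel
  have hQsQ : Qs * Q = (a⁻¹ : 𝕜) • (A - covLapF (fine L M) c m2 U) := by rw [← hpen, smul_smul, inv_mul_cancel₀ ha0, one_smul]
  -- the key cancellation: `G * (Qs*Q) * Mi = a⁻¹•(Mi − G)`
  have hkey : G * (Qs * Q) * Mi = (a⁻¹ : 𝕜) • (Mi - G) := by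
    rw [hQsQ, Matrix.mul_smul, Matrix.smul_mul, Matrix.mul_sub, Matrix.sub_mul, hGA, Matrix.one_mul, Matrix.mul_assoc, hMMi, Matrix.mul_one]
  have h2 : ((a ^ 2 : ℝ) : 𝕜) * (a⁻¹ : 𝕜) = (a : 𝕜) := by push_cast; field_simp
  have h2' : (a⁻¹ : 𝕜) * ((a ^ 2 : ℝ) : 𝕜) = (a : 𝕜) := by rw [mul_comm, h2]
  have h3 : ((a ^ 2 : ℝ) : 𝕜) * (a⁻¹ : 𝕜) = (a : 𝕜) := h2
  -- expand the product
  have hexp : effLapU T M a c m2 U * ((a⁻¹ : 𝕜) • 1 + Q * Mi * Qs)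
      = 1 + (a : 𝕜) • (Q * Mi * Qs) - (a : 𝕜) • (Q * G * Qs) - ((a ^ 2 : ℝ) : 𝕜) • (Q * (G * (Qs * Q) * Mi) * Qs) := by
    have h4 : Q * G * Qs * (Q * Mi * Qs) = Q * (G * (Qs * Q) * Mi) * Qs := by simp only [Matrix.mul_assoc]
    simp only [effLapU, ← hQ, ← hQs, ← hA, ← hG]
    simp only [Matrix.sub_mul, Matrix.mul_add, Matrix.smul_mul, Matrix.mul_smul, Matrix.one_mul, Matrix.mul_one, smul_sub, smul_smul, h2', inv_mul_cancel₀ ha0, one_smul, h4]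
    abel
  rw [hexp, hkey, Matrix.mul_smul, Matrix.smul_mul, smul_smul, h3, Matrix.mul_sub, Matrix.sub_mul, smul_sub]
  abel

/-- ★★★ **THE WOODBURY FORM OF THE BLOCK-FIELD COVARIANCE AT EVERY LINK FIELD**: `(Δ_eff(U))⁻¹ = a⁻¹·1 + Q(U)·(−cΔ_U+m²)⁻¹·Q(U)^*` — block-spin noise plus the covariant block average of the
covariant fine covariance (`a > 0`, `m² > 0`, `c ≥ 0`, every unitary `U`, every tree contour system).  At `U ≡ 1`: the tree's `N15KingModelRung.effLaplacian_inv_eq_noise_add_blockAvg` ⊗ 1.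
[cite: King1986, (2.13)–(2.14) p.653, (4.44)–(4.45) p.675; Balaban1985BackgroundPropagators, (3.19) p.393, (3.25) p.394] -/
theorem effLapU_inv_eq_noise_add_blockAvg {a c m2 : ℝ} (ha : 0 < a) (hc : 0 ≤ c) (hm : 0 < m2) {U : Tor (fine L M) × Fin (d + 1) → Matrix n n 𝕜} (hU : ∀ bd, U bd ∈ Matrix.unitaryGroup n 𝕜) :
    (effLapU T M a c m2 U)⁻¹ = (a⁻¹ : 𝕜) • 1 + covQ T M U * (covLapF (fine L M) c m2 U)⁻¹ * kingQadjU T M U :=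
  Matrix.inv_eq_right_inv (effLapU_mul_noise_add_blockAvg T M ha hc hm hU)

/-- The effective Laplacian is invertible at every `U`. [cite: King1986, (2.14) p.653] -/
theorem isUnit_effLapU {a c m2 : ℝ} (ha : 0 < a) (hc : 0 ≤ c) (hm : 0 < m2) {U : Tor (fine L M) × Fin (d + 1) → Matrix n n 𝕜} (hU : ∀ bd, U bd ∈ Matrix.unitaryGroup n 𝕜) :
    IsUnit (effLapU T M a c m2 U) :=
  (Matrix.isUnit_iff_isUnit_det _).mpr (Matrix.isUnit_det_of_right_inverse (effLapU_mul_noise_add_blockAvg T M ha hc hm hU))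

/-! ## §3 The form sandwich at every `U` -/

/-- ★ `Re⟨f, Q M⁻¹ Q^* f⟩ = L^{d+1}·Re⟨Qᴴf, M⁻¹(Qᴴf)⟩` (King's `η`-adjoint `Q^* = L^{d+1}Qᴴ`). [cite: King1986, (2.13) p.653] -/
theorem re_quadForm_kingQadjU_sandwich (B : Matrix (Tor (fine L M) × n) (Tor (fine L M) × n) 𝕜) (U : Tor (fine L M) × Fin (d + 1) → Matrix n n 𝕜) (f : Tor M × n → 𝕜) :
    RCLike.re (star f ⬝ᵥ ((covQ T M U * B * kingQadjU T M U) *ᵥ f))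
      = (L : ℝ) ^ (d + 1) * RCLike.re (star ((covQ T M U)ᴴ *ᵥ f) ⬝ᵥ (B *ᵥ ((covQ T M U)ᴴ *ᵥ f))) := by
  have hstar : star f ᵥ* covQ T M U = star ((covQ T M U)ᴴ *ᵥ f) := by rw [star_mulVec, conjTranspose_conjTranspose]
  have hcast : ((L : 𝕜) ^ (d + 1)) = (((L : ℝ) ^ (d + 1) : ℝ) : 𝕜) := by push_cast; ring
  rw [kingQadjU, Matrix.mul_smul, Matrix.smul_mulVec, dotProduct_smul, smul_eq_mul, ← mulVec_mulVec, ← mulVec_mulVec, dotProduct_mulVec, hstar, hcast, RCLike.re_ofReal_mul]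

/-- ★ `L^{d+1}·‖Qᴴf‖² = ‖f‖²` at every unitary `U` (from `Q(U)Q(U)ᴴ = L^{−(d+1)}·1`, PART Ϥ-c). [cite: Balaban1985BackgroundPropagators, (3.19) p.393] -/
theorem sum_norm_sq_conjTranspose_covQ_mulVec {U : Tor (fine L M) × Fin (d + 1) → Matrix n n 𝕜} (hU : ∀ bd, U bd ∈ Matrix.unitaryGroup n 𝕜) (f : Tor M × n → 𝕜) :
    (L : ℝ) ^ (d + 1) * ‖(toLp 2 ((covQ T M U)ᴴ *ᵥ f) : EuclideanSpace 𝕜 (Tor (fine L M) × n))‖ ^ 2 = ‖(toLp 2 f : EuclideanSpace 𝕜 (Tor M × n))‖ ^ 2 := by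
  have hL : ((L : 𝕜) ^ (d + 1)) ≠ 0 := pow_ne_zero _ (by exact_mod_cast NeZero.ne L)
  have key : star ((covQ T M U)ᴴ *ᵥ f) ⬝ᵥ ((covQ T M U)ᴴ *ᵥ f) = ((L : 𝕜) ^ (d + 1))⁻¹ * (star f ⬝ᵥ f) := by
    rw [star_mulVec, conjTranspose_conjTranspose, ← dotProduct_mulVec, mulVec_mulVec, covQ_mul_conjTranspose T M hU, Matrix.smul_mulVec, one_mulVec, dotProduct_smul, smul_eq_mul]
  rw [EuclideanSpace.norm_sq_eq, EuclideanSpace.norm_sq_eq]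
  have h1 : ∑ p, ‖(toLp 2 ((covQ T M U)ᴴ *ᵥ f) : EuclideanSpace 𝕜 (Tor (fine L M) × n)) p‖ ^ 2 = RCLike.re (star ((covQ T M U)ᴴ *ᵥ f) ⬝ᵥ ((covQ T M U)ᴴ *ᵥ f)) := by
    rw [Literature.LinearAlgebra.Matrix.RayleighQuotient.re_star_dotProduct_self]
  have h2 : ∑ p, ‖(toLp 2 f : EuclideanSpace 𝕜 (Tor M × n)) p‖ ^ 2 = RCLike.re (star f ⬝ᵥ f) := by
    rw [Literature.LinearAlgebra.Matrix.RayleighQuotient.re_star_dotProduct_self]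
  rw [h1, h2, key, show ((L : 𝕜) ^ (d + 1))⁻¹ = ((((L : ℝ) ^ (d + 1))⁻¹ : ℝ) : 𝕜) by push_cast; ring, RCLike.re_ofReal_mul, ← mul_assoc,
    mul_inv_cancel₀ (pow_ne_zero _ (by exact_mod_cast NeZero.ne L)), one_mul]

/-- ★★★ **THE BLOCK-FIELD COVARIANCE DOMINATES THE NOISE AT EVERY `U`**: `a⁻¹·‖f‖² ≤ Re⟨f,(Δ_eff(U))⁻¹f⟩` (`a > 0`, `m² > 0`, `c ≥ 0`, unitary `U`) — the covariant block average of the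
positive covariant fine covariance is positive. [cite: King1986, (2.14) p.653, (4.45) p.675; Balaban1985BackgroundPropagators, (3.25) p.394] -/
theorem re_quadForm_effLapU_inv_ge {a c m2 : ℝ} (ha : 0 < a) (hc : 0 ≤ c) (hm : 0 < m2) {U : Tor (fine L M) × Fin (d + 1) → Matrix n n 𝕜} (hU : ∀ bd, U bd ∈ Matrix.unitaryGroup n 𝕜)
    (f : Tor M × n → 𝕜) : a⁻¹ * ‖(toLp 2 f : EuclideanSpace 𝕜 (Tor M × n))‖ ^ 2 ≤ RCLike.re (star f ⬝ᵥ ((effLapU T M a c m2 U)⁻¹ *ᵥ f)) := by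
  rw [effLapU_inv_eq_noise_add_blockAvg T M ha hc hm hU, add_mulVec, dotProduct_add, map_add, Matrix.smul_mulVec, one_mulVec, dotProduct_smul, smul_eq_mul,
    re_quadForm_kingQadjU_sandwich]
  have hnn : 0 ≤ RCLike.re (star ((covQ T M U)ᴴ *ᵥ f) ⬝ᵥ ((covLapF (fine L M) c m2 U)⁻¹ *ᵥ ((covQ T M U)ᴴ *ᵥ f))) :=
    (posDef_covLapF_inv (fine L M) hc hm hU).posSemidef.re_dotProduct_nonneg _
  have hre : RCLike.re ((a⁻¹ : 𝕜) * (star f ⬝ᵥ f)) = a⁻¹ * ‖(toLp 2 f : EuclideanSpace 𝕜 (Tor M × n))‖ ^ 2 := by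
    rw [show (a⁻¹ : 𝕜) = ((a⁻¹ : ℝ) : 𝕜) by push_cast; rfl, RCLike.re_ofReal_mul, EuclideanSpace.norm_sq_eq, Literature.LinearAlgebra.Matrix.RayleighQuotient.re_star_dotProduct_self]
  rw [hre]
  have : 0 ≤ (L : ℝ) ^ (d + 1) * RCLike.re (star ((covQ T M U)ᴴ *ᵥ f) ⬝ᵥ ((covLapF (fine L M) c m2 U)⁻¹ *ᵥ ((covQ T M U)ᴴ *ᵥ f))) := by positivity
  linarith

/-- ★★★ **… AND EXCEEDS IT BY AT MOST `m⁻²`**: `Re⟨f,(Δ_eff(U))⁻¹f⟩ ≤ (a⁻¹ + m⁻²)·‖f‖²` at every unitary `U` (`‖M_U⁻¹‖ ≤ m⁻²`, Ͱ-f, and `L^{d+1}‖Q(U)ᴴf‖² = ‖f‖²`) — the curved twin of PART Ϟ-h's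
`A = 0` box sandwich `a⁻¹ ≤ (Δ^{(K)}_Ω)⁻¹ ≤ a⁻¹ + m⁻²`, uniform in `U`, `L` and the volume. [cite: King1986, (2.14) p.653, (4.45) p.675; Balaban1985BackgroundPropagators, (3.39) p.397] -/
theorem re_quadForm_effLapU_inv_le {a c m2 : ℝ} (ha : 0 < a) (hc : 0 ≤ c) (hm : 0 < m2) {U : Tor (fine L M) × Fin (d + 1) → Matrix n n 𝕜} (hU : ∀ bd, U bd ∈ Matrix.unitaryGroup n 𝕜)
    (f : Tor M × n → 𝕜) : RCLike.re (star f ⬝ᵥ ((effLapU T M a c m2 U)⁻¹ *ᵥ f)) ≤ (a⁻¹ + m2⁻¹) * ‖(toLp 2 f : EuclideanSpace 𝕜 (Tor M × n))‖ ^ 2 := by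
  rw [effLapU_inv_eq_noise_add_blockAvg T M ha hc hm hU, add_mulVec, dotProduct_add, map_add, Matrix.smul_mulVec, one_mulVec, dotProduct_smul, smul_eq_mul,
    re_quadForm_kingQadjU_sandwich]
  set w := (covQ T M U)ᴴ *ᵥ f with hw
  have hre : RCLike.re ((a⁻¹ : 𝕜) * (star f ⬝ᵥ f)) = a⁻¹ * ‖(toLp 2 f : EuclideanSpace 𝕜 (Tor M × n))‖ ^ 2 := by
    rw [show (a⁻¹ : 𝕜) = ((a⁻¹ : ℝ) : 𝕜) by push_cast; rfl, RCLike.re_ofReal_mul, EuclideanSpace.norm_sq_eq, Literature.LinearAlgebra.Matrix.RayleighQuotient.re_star_dotProduct_self]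
  rw [hre]
  -- `Re⟨w, M⁻¹w⟩ ≤ ‖w‖·‖M⁻¹w‖ ≤ m⁻²‖w‖²`
  have hCS := re_star_dotProduct_le_norm_mul_norm (fine L M) w ((covLapF (fine L M) c m2 U)⁻¹ *ᵥ w)
  have hinv := norm_toLp_inv_mulVec_le (fine L M) hc hm hU w
  have hw2 := sum_norm_sq_conjTranspose_covQ_mulVec T M hU f
  rw [← hw] at hw2
  set A := ‖(toLp 2 w : EuclideanSpace 𝕜 (Tor (fine L M) × n))‖ with hA
  have hA0 : 0 ≤ A := norm_nonneg _
  have hL0 : (0 : ℝ) ≤ (L : ℝ) ^ (d + 1) := by positivity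
  have h1 : RCLike.re (star w ⬝ᵥ ((covLapF (fine L M) c m2 U)⁻¹ *ᵥ w)) ≤ m2⁻¹ * A ^ 2 := by
    calc RCLike.re (star w ⬝ᵥ ((covLapF (fine L M) c m2 U)⁻¹ *ᵥ w)) ≤ A * ‖(toLp 2 ((covLapF (fine L M) c m2 U)⁻¹ *ᵥ w) : EuclideanSpace 𝕜 (Tor (fine L M) × n))‖ := hCS
      _ ≤ A * (m2⁻¹ * A) := mul_le_mul_of_nonneg_left hinv hA0
      _ = m2⁻¹ * A ^ 2 := by ring
  have h2 : (L : ℝ) ^ (d + 1) * RCLike.re (star w ⬝ᵥ ((covLapF (fine L M) c m2 U)⁻¹ *ᵥ w)) ≤ m2⁻¹ * ‖(toLp 2 f : EuclideanSpace 𝕜 (Tor M × n))‖ ^ 2 := by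
    calc (L : ℝ) ^ (d + 1) * RCLike.re (star w ⬝ᵥ ((covLapF (fine L M) c m2 U)⁻¹ *ᵥ w)) ≤ (L : ℝ) ^ (d + 1) * (m2⁻¹ * A ^ 2) := mul_le_mul_of_nonneg_left h1 hL0
      _ = m2⁻¹ * ((L : ℝ) ^ (d + 1) * A ^ 2) := by ring
      _ = m2⁻¹ * ‖(toLp 2 f : EuclideanSpace 𝕜 (Tor M × n))‖ ^ 2 := by rw [hw2]
  linarith

/-- ★★ **THE `U`-UNIFORM SANDWICH OF THE BLOCK-FIELD COVARIANCE FORM** (every unitary `U`, every tree contour system, every volume; `a, m² > 0`, `c ≥ 0`):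
`a⁻¹‖f‖² ≤ Re⟨f,(Δ_eff(U))⁻¹f⟩ ≤ (a⁻¹ + m⁻²)‖f‖²` — WHAT THE CURVED CASE ADDS to NE2's unit layer in operator norm: nothing is lost and nothing is gained at this order.
[cite: King1986, (2.14) p.653, (4.45) p.675; Balaban1985BackgroundPropagators, (3.19) p.393, (3.25) p.394, (3.39) p.397] -/
theorem king_blockField_covariance_sandwich {a c m2 : ℝ} (ha : 0 < a) (hc : 0 ≤ c) (hm : 0 < m2) {U : Tor (fine L M) × Fin (d + 1) → Matrix n n 𝕜} (hU : ∀ bd, U bd ∈ Matrix.unitaryGroup n 𝕜)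
    (f : Tor M × n → 𝕜) :
    a⁻¹ * ‖(toLp 2 f : EuclideanSpace 𝕜 (Tor M × n))‖ ^ 2 ≤ RCLike.re (star f ⬝ᵥ ((effLapU T M a c m2 U)⁻¹ *ᵥ f))
      ∧ RCLike.re (star f ⬝ᵥ ((effLapU T M a c m2 U)⁻¹ *ᵥ f)) ≤ (a⁻¹ + m2⁻¹) * ‖(toLp 2 f : EuclideanSpace 𝕜 (Tor M × n))‖ ^ 2 :=
  ⟨re_quadForm_effLapU_inv_ge T M ha hc hm hU f, re_quadForm_effLapU_inv_le T M ha hc hm hU f⟩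

end Summit.QuantumFields.YangMills.BalabanUVNodes.N15KingModelRung.CovariantBlock

end
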